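import Mathlib
import Literature.Claims.NS.Shahmurov2026b
import Literature.Analysis.FluidPDE.AxisymHouLiVariables
import Literature.Analysis.FluidPDE.ChenHouMeridianSystem
import HarnessLib

/-!
# NS-claims map, C12 (Shahmurov 2026b, arXiv:2604.09949 v1): kernel checks of the typed proof skeleton
# `Literature.Claims.NS.Shahmurov2026b` (p464917)

Two negations, each by ONE explicit smooth field (print locators: R. Shahmurov, *Computer-assisted
proof of finite-time blow-up for axisymmetric Navier–Stokes on 𝕋³ via a lifted five-dimensional
formulation*, arXiv:2604.09949 v1, 2026-04):

* `not_Step_1` — **Step 1 = S-LIFT** (the identification «solution of the printed lifted/profile system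
  (4.2), (4.4)–(4.6) ⇒ its self-similar reconstruction (12.2) is a classical Navier–Stokes solution on
  ℝ³ × (0,T*)», Def 3.1 / (3.3) p.2, Def 4.3 (4.4)–(4.6) p.3, consumed at Thm 12.1 p.9; skeleton decl
  `Step_1`, the first Step of `claim_of_steps`). Witness (ii): `Ω̄ ≡ 0`, `ψ̄(ρ,ζ) = ρ⁴ζ` — a smooth
  solution of the printed stationary system on the open half-plane (`W = ψ̄/ρ⁴ = ζ`, `ℬW = 0 = ∂_ζ(Ω̄²)`;
  `𝒢(0,ν) = 0`) — whose printed recovery (4.5) gives `ū^ρ = −ρ`, `ū^ζ = 4ζ`, i.e. the smooth linear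
  field `ū(y) = (−y₀, −y₁, 4y₂)` on ℝ³ (it agrees with the reconstruction `ū^ρ e_ρ + ρΩ̄ e_θ + ū^ζ e_z`
  off the axis). Its self-similar field (12.2) at time `t < T*` is `(T*−t)⁻¹ ū`, with 3-D divergence
  `2/(T*−t) ≠ 0`: not incompressible, hence not a Navier–Stokes solution. Mechanism: the printed «5D
  incompressibility» (3.3)/(4.6) `∂_ρū^ρ + (3/ρ)ū^ρ + ∂_ζū^ζ = 0` is `div₃ u + 2u^ρ/ρ = 0`, not `div₃ u = 0`.
* `not_LiftedIncompressibility` — the support decl for **eq. (3.3) p.2 as printed** (erratum column,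
  not on the path): the smooth axisymmetric divergence-free no-swirl field `u(x) = (x₀x₂, x₁x₂, −x₂²)`
  (`u^r = rz`, `u^z = −z²`) has `∂ᵣu^r + (3/r)u^r + ∂_zu^z = 2z ≠ 0` at `(r,z) = (1,1)`.

Hypothesis-fit of witness (ii) follows typist-8's QA scratch `C12WitnessFit.lean` (re-proved here).
Axioms: `propext`, `Classical.choice`, `Quot.sound` only.
WHAT THIS IS NOT: not a claim about NS regularity or blow-up; not a claim about any author beyond
the typed locator.
-/

noncomputable section

-- The summit's canonical theorem namespace repeats the summit name (single-conjunct summit).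
set_option linter.dupNamespace false

namespace Summit.NavierStokesRegularity.NavierStokesRegularity.Theorems.Shahmurov2026b

open Set Filter Topology WithLp
open scoped ContDiff
open Literature.Analysis.FluidPDE Literature.Claims.NS.Shahmurov2026b

local notation "ℝ³" => EuclideanSpace ℝ (Fin 3)

/-! ## Witness (ii): the `Ω̄ ≡ 0`, `ψ̄ = ρ⁴ζ` member of the printed profile class -/

/-- `ψ̄(ρ,ζ) = ρ⁴ζ`. -/
def psiW (q : ℝ × ℝ) : ℝ := q.1 ^ 4 * q.2

/-- `ψ̄ = ρ⁴ζ` is a polynomial, hence `C^∞` on `ℝ²`. -/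
theorem contDiff_psiW : ContDiff ℝ ∞ psiW := by
  unfold psiW; fun_prop


/-- On the open half-plane `W = ψ̄/ρ⁴ = ζ`. -/
theorem streamW_psiW_eqOn : EqOn (streamW psiW) (fun q => q.2) {q : ℝ × ℝ | 0 < q.1} := by
  intro q hq
  have h : q.1 ≠ 0 := ne_of_gt hq
  simp only [streamW, psiW]
  field_simp

/-- `∂_ρ W = 0` on `{0 < ρ}` for `W = ψ̄/ρ⁴ = ζ`. -/
theorem derivR_streamW_psiW {q : ℝ × ℝ} (hq : 0 < q.1) : derivR (streamW psiW) q = 0 := by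
  have hev : streamW psiW =ᶠ[𝓝 q] fun q => q.2 :=
    streamW_psiW_eqOn.eventuallyEq_of_mem ((isOpen_lt continuous_const continuous_fst).mem_nhds hq)
  rw [derivR_apply, hev.fderiv_eq]
  simp [fderiv_snd]

/-- `∂_ζ W = 1` on `{0 < ρ}` for `W = ψ̄/ρ⁴ = ζ`. -/
theorem derivZ_streamW_psiW {q : ℝ × ℝ} (hq : 0 < q.1) : derivZ (streamW psiW) q = 1 := by
  have hev : streamW psiW =ᶠ[𝓝 q] fun q => q.2 :=
    streamW_psiW_eqOn.eventuallyEq_of_mem ((isOpen_lt continuous_const continuous_fst).mem_nhds hq)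
  rw [derivZ_apply, hev.fderiv_eq]
  simp [fderiv_snd]

/-- `∂_ρ∂_ρ W = 0` on `{0 < ρ}` for `W = ζ`. -/
theorem derivR_derivR_streamW_psiW {q : ℝ × ℝ} (hq : 0 < q.1) :
    derivR (derivR (streamW psiW)) q = 0 := by
  have hev : derivR (streamW psiW) =ᶠ[𝓝 q] fun _ => (0 : ℝ) :=
    (show EqOn (derivR (streamW psiW)) (fun _ => (0 : ℝ)) {q : ℝ × ℝ | 0 < q.1} from
      fun q' hq' => derivR_streamW_psiW hq').eventuallyEq_of_mem ((isOpen_lt continuous_const continuous_fst).mem_nhds hq)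
  rw [derivR_apply, hev.fderiv_eq]
  simp

/-- `∂_ζ∂_ζ W = 0` on `{0 < ρ}` for `W = ζ`. -/
theorem derivZ_derivZ_streamW_psiW {q : ℝ × ℝ} (hq : 0 < q.1) :
    derivZ (derivZ (streamW psiW)) q = 0 := by
  have hev : derivZ (streamW psiW) =ᶠ[𝓝 q] fun _ => (1 : ℝ) :=
    (show EqOn (derivZ (streamW psiW)) (fun _ => (1 : ℝ)) {q : ℝ × ℝ | 0 < q.1} from
      fun q' hq' => derivZ_streamW_psiW hq').eventuallyEq_of_mem ((isOpen_lt continuous_const continuous_fst).mem_nhds hq)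
  rw [derivZ_apply, hev.fderiv_eq]
  simp

/-- **Witness (ii) solves the printed stationary system** (4.2) + (4.4) on `0 < ρ` with `Ω̄ ≡ 0`. -/
theorem isProfilePair_witness (ν : ℝ) : IsProfilePair ν (fun _ => 0) psiW where
  smooth_Ω := contDiff_const
  smooth_ψ := contDiff_psiW
  profile_eq q hq := by
    simp [profileOp, GeneralizedAxisymNS.lap, derivR_const, derivZ_const]
  recovery q hq := by
    unfold RecoveryLaw
    simp only [GeneralizedAxisymNS.lap, derivR_derivR_streamW_psiW hq, derivR_streamW_psiW hq,
      derivZ_derivZ_streamW_psiW hq]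
    simp

/-- `∂_ζ ψ̄ = ρ⁴` for `ψ̄ = ρ⁴ζ` (so the printed drift (4.5) gives `ū^ρ = −ρ`). -/
theorem derivZ_psiW (r z : ℝ) : derivZ psiW (r, z) = r ^ 4 := by
  rw [derivZ_slice contDiff_psiW]
  simp only [psiW]
  rw [deriv_const_mul _ differentiableAt_id]
  simp

/-- `∂_ρ ψ̄ = 4ρ³ζ` for `ψ̄ = ρ⁴ζ` (so the printed drift (4.5) gives `ū^ζ = 4ζ`). -/
theorem derivR_psiW (r z : ℝ) : derivR psiW (r, z) = 4 * r ^ 3 * z := by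
  rw [derivR_slice contDiff_psiW]
  simp only [psiW]
  rw [deriv_mul_const (by fun_prop)]
  simp

/-- The recovered field `ū(y) = (−y₀, −y₁, 4y₂)` as a linear map. -/
def ubarLin : ℝ³ →ₗ[ℝ] ℝ³ where
  toFun y := toLp 2 ![-y 0, -y 1, 4 * y 2]
  map_add' y y' := by
    ext i; fin_cases i <;> simp <;> ring
  map_smul' c y := by
    ext i
    fin_cases i <;> simp
    ring

/-- … as a continuous linear map. -/
def ubarCLM : ℝ³ →L[ℝ] ℝ³ := LinearMap.toContinuousLinearMap ubarLin

/-- `ū(y) = (−y₀, −y₁, 4y₂)`. -/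
def ubarW (y : ℝ³) : ℝ³ := toLp 2 ![-y 0, -y 1, 4 * y 2]

/-- `ū` is the continuous linear map `ubarCLM` (definitionally). -/
theorem ubarW_eq : ubarW = ⇑ubarCLM := rfl

/-- `ū` is `C^∞` (linear). -/
theorem contDiff_ubarW : ContDiff ℝ ∞ ubarW := by
  rw [ubarW_eq]; exact ubarCLM.contDiff

/-- `ū` IS the printed reconstruction of witness (ii) off the axis: `ū^ρ = −ρ⁻³∂_ζψ̄ = −ρ`,
`ρΩ̄ = 0`, `ū^ζ = ρ⁻³∂_ρψ̄ = 4ζ`. -/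
theorem ubarW_eq_reconstruct (y : ℝ³) (hy : cylRadius y ≠ 0) :
    ubarW y = reconstruct (fun _ => 0) psiW y := by
  have hR : driftR psiW (cylRadius y, y 2) = -cylRadius y := by
    simp only [driftR, derivZ_psiW]
    field_simp
  have hZ : driftZ psiW (cylRadius y, y 2) = 4 * y 2 := by
    simp only [driftZ, derivR_psiW]
    field_simp
  have h0 : cylRadius y * ((cylRadius y)⁻¹ * y 0) = y 0 := by field_simp
  have h1 : cylRadius y * ((cylRadius y)⁻¹ * y 1) = y 1 := by field_simp
  ext i
  fin_cases i <;> simp [reconstruct, ubarW, eR, eTheta, eZ, hR, hZ, h0, h1]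

/-- The self-similar field (12.2) of a LINEAR profile: `u(·,t) = (√(T−t))⁻² ū`. -/
theorem selfSimilar_ubarW (T t : ℝ) :
    selfSimilar T ubarW t =
      fun x => ((Real.sqrt (T - t))⁻¹ * (Real.sqrt (T - t))⁻¹) • ubarW x := by
  funext x
  simp only [selfSimilar, ubarW_eq, map_smul, smul_smul]

/-- The derivative of `x ↦ k • ū x` is the constant map `k • ubarCLM`. -/
theorem fderiv_smul_ubarW (k : ℝ) (x : ℝ³) :
    fderiv ℝ (fun y => k • ubarW y) x = k • ubarCLM := by
  rw [ubarW_eq]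
  exact (ubarCLM.hasFDerivAt.const_smul k).fderiv

/-- `div (k ū) = 2k` (trace of `k · diag(−1,−1,4)`). -/
theorem divergence_smul_ubarW (k : ℝ) (x : ℝ³) :
    VectorCalculus.divergence (fun y => k • ubarW y) x = 2 * k := by
  rw [divergence_eq_sum_three, fderiv_smul_ubarW]
  simp [ubarCLM, ubarLin]
  ring

/-- The self-similar reconstruction of witness (ii) is NOT divergence-free at any `t < T*`:
`div u(·,t) = 2/(T*−t)`. -/
theorem not_isDivFree_selfSimilar_ubarW {T t : ℝ} (ht : t < T) :
    ¬ VectorCalculus.IsDivFree (selfSimilar T ubarW t) := by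
  intro h
  have h0 := h 0
  rw [selfSimilar_ubarW, divergence_smul_ubarW] at h0
  have hs : 0 < Real.sqrt (T - t) := Real.sqrt_pos.2 (by linarith)
  have : (0 : ℝ) < 2 * ((Real.sqrt (T - t))⁻¹ * (Real.sqrt (T - t))⁻¹) := by positivity
  linarith

/-- **Refutes `Step_1` (S-LIFT)** — Def 3.1 / (3.3) p.2, Def 4.3 (4.4)–(4.6) p.3, consumed at Thm 12.1
p.9: witness (ii) meets every hypothesis of the Step (solution of the printed profile system, smooth
field agreeing with the reconstruction off the axis), and its self-similar field violates `∇·u = 0`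
at `t = T*/2` (here `ν = T* = 1`).
WHAT THIS IS NOT: not a claim about NS regularity or blow-up; not a claim about any author beyond the
typed locator. -/
theorem not_Step_1 : ¬ Step_1 := by
  intro h
  obtain ⟨p, hsol⟩ := h 1 one_pos 1 one_pos (fun _ => 0) psiW ubarW (isProfilePair_witness 1)
    contDiff_ubarW ubarW_eq_reconstruct
  exact not_isDivFree_selfSimilar_ubarW (T := 1) (t := 1 / 2) (by norm_num)
    (hsol.divFree (1 / 2) ⟨by norm_num, by norm_num⟩)

/-- Model-independent form for the referee: ANY `Step_1`-type identification already fails on the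
single profile `(Ω̄, ψ̄) = (0, ρ⁴ζ)` — for every `ν > 0`, `T* > 0` there is NO pressure making (12.2) a
classical Navier–Stokes solution on `(0,T*)`. -/
theorem no_pressure_for_witness (ν T : ℝ) (hT : 0 < T) :
    ¬ ∃ p : ℝ → ℝ³ → ℝ, IsClassicalNSSolutionOn (Ioo 0 T) ν 0 (selfSimilar T ubarW) p := by
  rintro ⟨p, hsol⟩
  exact not_isDivFree_selfSimilar_ubarW (T := T) (t := T / 2) (by linarith)
    (hsol.divFree (T / 2) ⟨by linarith, by linarith⟩)

/-! ## Witness (i): eq. (3.3) p.2 as printed fails for `u = (x₀x₂, x₁x₂, −x₂²)` (erratum column) -/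

/-- third coordinate as a continuous linear functional -/
def π₂ : ℝ³ →L[ℝ] ℝ := EuclideanSpace.proj (2 : Fin 3)

/-- `π₂ x = x₂`. -/
@[simp] theorem π₂_apply (x : ℝ³) : π₂ x = x 2 := rfl

/-- `e₂ = (0,0,1)`. -/
def e₂ : ℝ³ := EuclideanSpace.single (2 : Fin 3) (1 : ℝ)

/-- `u(x) = x₂·x − 2x₂²·e₂ = (x₀x₂, x₁x₂, −x₂²)` (`u^r = rz`, `u^θ = 0`, `u^z = −z²`). -/
def uPoly : ℝ³ → ℝ³ := fun x => (π₂ x) • x - (2 * (π₂ x) ^ 2) • e₂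

/-- Coordinates of the witness `u(x) = (x₀x₂, x₁x₂, −x₂²)`. -/
theorem uPoly_apply (x : ℝ³) (i : Fin 3) :
    uPoly x i = x 2 * x i - 2 * (x 2) ^ 2 * (e₂ : ℝ³) i := by
  simp [uPoly, π₂, e₂, smul_eq_mul]

/-- `u₀ = x₀x₂`. -/
@[simp] theorem uPoly_apply_zero (x : ℝ³) : uPoly x 0 = x 0 * x 2 := by
  rw [uPoly_apply]; simp [e₂]; ring
/-- `u₁ = x₁x₂`. -/
@[simp] theorem uPoly_apply_one (x : ℝ³) : uPoly x 1 = x 1 * x 2 := by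
  rw [uPoly_apply]; simp [e₂]; ring
/-- `u₂ = −x₂²`. -/
@[simp] theorem uPoly_apply_two (x : ℝ³) : uPoly x 2 = -(x 2) ^ 2 := by
  rw [uPoly_apply]; simp [e₂]; ring

/-- the derivative of `uPoly` at `x`: `v ↦ v₂·x + x₂·v − 4x₂v₂·e₂` -/
def DuPoly (x : ℝ³) : ℝ³ →L[ℝ] ℝ³ :=
  (π₂ x) • ContinuousLinearMap.id ℝ ℝ³ + π₂.smulRight x - ((4 * π₂ x) • π₂).smulRight e₂

/-- The Fréchet derivative of `u` at `x` is `DuPoly x` (product rule on `π₂ • id − 2π₂² • e₂`). -/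
theorem hasFDerivAt_uPoly (x : ℝ³) : HasFDerivAt uPoly (DuPoly x) x := by
  have h1 : HasFDerivAt (fun y : ℝ³ => π₂ y) π₂ x := π₂.hasFDerivAt
  have hid : HasFDerivAt (fun y : ℝ³ => y) (ContinuousLinearMap.id ℝ ℝ³) x := hasFDerivAt_id x
  have hA : HasFDerivAt (fun y : ℝ³ => (π₂ y) • y)
      ((π₂ x) • ContinuousLinearMap.id ℝ ℝ³ + π₂.smulRight x) x := h1.smul hid
  have hsq : HasFDerivAt (fun y : ℝ³ => 2 * (π₂ y) ^ 2) ((4 * π₂ x) • π₂) x := by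
    refine ((h1.pow 2).const_mul 2).congr_fderiv ?_
    ext v
    simp
    ring
  have hB : HasFDerivAt (fun y : ℝ³ => (2 * (π₂ y) ^ 2) • e₂) (((4 * π₂ x) • π₂).smulRight e₂) x :=
    hsq.smul_const e₂
  exact hA.sub hB

/-- `fderiv ℝ u x = DuPoly x`. -/
theorem fderiv_uPoly (x : ℝ³) : fderiv ℝ uPoly x = DuPoly x := (hasFDerivAt_uPoly x).fderiv

/-- `u` is `C^∞` (polynomial in the coordinates). -/
theorem contDiff_uPoly : ContDiff ℝ ∞ uPoly := by
  unfold uPoly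
  apply ContDiff.sub
  · exact (π₂.contDiff).smul contDiff_id
  · exact (contDiff_const.mul (π₂.contDiff.pow 2)).smul contDiff_const

/-- `div u = x₂ + x₂ − 2x₂ = 0`. -/
theorem divergence_uPoly (x : ℝ³) : VectorCalculus.divergence uPoly x = 0 := by
  rw [divergence_eq_sum_three, fderiv_uPoly]
  simp [DuPoly, e₂, smul_eq_mul]
  ring

/-- `u` is divergence-free on `ℝ³` (`x₂ + x₂ − 2x₂ = 0`). -/
theorem isDivFree_uPoly : NSWave0.IsDivFree uPoly := fun x => divergence_uPoly x

/-- `u` is axisymmetric about the `x₂`-axis (tree `IsAxisymmetric`: `u(Rx) = R u(x)` for rotations about `e_z`). -/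
theorem isAxisymmetric_uPoly : IsAxisymmetric uPoly := by
  intro θ x
  ext i
  fin_cases i <;> simp [rotZ, uPoly_apply_zero, uPoly_apply_one, uPoly_apply_two] <;> ring


/-- On the open half-plane the meridian radial profile of `uPoly` is `u^r(r,z) = rz`. -/
theorem radialVelocity_uPoly_meridianPoint {q : ℝ × ℝ} (hq : 0 < q.1) :
    radialVelocity uPoly (meridianPoint q) = q.1 * q.2 := by
  have hr : cylRadius (meridianPoint q) = q.1 := cylRadius_meridianPoint hq.le
  have hq0 : q.1 ≠ 0 := ne_of_gt hq
  simp only [radialVelocity, eR, hr]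
  rw [EuclideanSpace.inner_eq_star_dotProduct]
  simp [Fin.sum_univ_three, dotProduct, uPoly_apply_zero, uPoly_apply_one, uPoly_apply_two]
  field_simp

/-- `u^r(r,z) = rz` as an identity of functions on the open half-plane `{0 < r}`. -/
theorem radialVelocity_uPoly_eqOn :
    EqOn (fun q' : ℝ × ℝ => radialVelocity uPoly (meridianPoint q')) (fun q' => q'.1 * q'.2)
      {q : ℝ × ℝ | 0 < q.1} :=
  fun _ hq => radialVelocity_uPoly_meridianPoint hq

/-- The meridian axial profile of `uPoly` is `u^z(r,z) = −z²` (everywhere). -/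
theorem axialVelocity_uPoly_eq :
    (fun q' : ℝ × ℝ => axialVelocity uPoly (meridianPoint q')) = fun q' => -(q'.2) ^ 2 := by
  funext q
  simp [axialVelocity, uPoly_apply_two]

/-- `∂_r u^r (r,z) = z` for `0 < r` (witness (i)). -/
theorem derivR_radialVelocity_uPoly {r : ℝ} (hr : 0 < r) (z : ℝ) :
    derivR (fun q' : ℝ × ℝ => radialVelocity uPoly (meridianPoint q')) (r, z) = z := by
  have hev : (fun q' : ℝ × ℝ => radialVelocity uPoly (meridianPoint q')) =ᶠ[𝓝 (r, z)]
      fun q' => q'.1 * q'.2 :=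
    radialVelocity_uPoly_eqOn.eventuallyEq_of_mem ((isOpen_lt continuous_const continuous_fst).mem_nhds (by exact hr))
  rw [derivR_apply, hev.fderiv_eq, ← derivR_apply,
    derivR_slice (G := fun q' : ℝ × ℝ => q'.1 * q'.2) (by fun_prop)]
  simp

/-- `∂_z u^z (r,z) = −2z` (witness (i)). -/
theorem derivZ_axialVelocity_uPoly (r z : ℝ) :
    derivZ (fun q' : ℝ × ℝ => axialVelocity uPoly (meridianPoint q')) (r, z) = -(2 * z) := by
  rw [axialVelocity_uPoly_eq, derivZ_slice (G := fun q' : ℝ × ℝ => -(q'.2) ^ 2) (by fun_prop)]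
  simp

/-- **Refutes `LiftedIncompressibility`** (eq. (3.3) p.2 as printed; erratum column): for the
axisymmetric divergence-free `u = (x₀x₂, x₁x₂, −x₂²)` the printed lifted law reads
`∂ᵣu^r + (3/r)u^r + ∂_zu^z = z + 3z − 2z = 2z`, which is `2 ≠ 0` at `(r,z) = (1,1)`.
WHAT THIS IS NOT: not a claim about NS regularity or blow-up; not a claim about any author beyond the
typed locator. -/
theorem not_LiftedIncompressibility : ¬ LiftedIncompressibility := by
  intro h
  have e := h uPoly contDiff_uPoly isAxisymmetric_uPoly isDivFree_uPoly (1, 1) one_pos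
  rw [derivR_radialVelocity_uPoly one_pos, derivZ_axialVelocity_uPoly,
    radialVelocity_uPoly_meridianPoint (q := (1, 1)) one_pos] at e
  norm_num at e

end Summit.NavierStokesRegularity.NavierStokesRegularity.Theorems.Shahmurov2026b

end
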